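import Mathlib
import Summits.Ventures.PercRepro2.M9NoPocketHarris
import Summits.Ventures.PercRepro2.M9QuadHarrisPow

/-!
# The 2EXHD quad inequality on the powerset of a finite set (blind cell PercRepro2, p3 g36,
2026-08-29; `proofs/P3-NPHDR.md` §5′, the form used by the unit assembly)

`M9QuadHarrisTwo` states the quad inequality of the sharpened crux on the hypercube
`Finset ι`; here it is restated on `N.powerset` with the relative complement, like
`M9QuadHarrisPow`, and with the counting hypothesis in its sharp form: `N₂ ≥ 2` is only needed
when `ℓ N = 1` AND some proper non-empty subset links (`ℓ S ≠ 0`) — when no proper subset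
links, the doubly-reached part is `≤ 0` by the antisymmetry alone (`quad_two_ex_hd_nonpos_powerset`).
Own work; std axioms.
-/

namespace Summit.Ventures.PercRepro2

namespace M9Reduce

open Finset

variable {β : Type*} [DecidableEq β]

/-- **The 2EXHD quad inequality on the powerset of `N`.** -/
theorem quad_two_ex_hd_nonpos_powerset [Fintype β] (N : Finset β) {ℓ HY HW : Finset β → ℤ}
    (hℓ : ∀ S ⊆ N, ∀ T ⊆ N, S ⊆ T → ℓ S ≤ ℓ T) (hℓ0 : ∀ S, 0 ≤ ℓ S)
    (hℓ1 : ∀ S, ℓ S ≤ 1) (hℓe : ℓ ∅ = 0)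
    (hW : ∀ S ⊆ N, ∀ T ⊆ N, S ⊆ T → HW S ≤ HW T) (hYW : ∀ S ⊆ N, HY S ≤ HW S) {N₂ : ℤ}
    (hN₂0 : 0 ≤ N₂)
    (hN₂ : ℓ N = 1 → (∃ S ∈ N.powerset.filter (fun S => S ≠ ∅ ∧ S ≠ N), ℓ S ≠ 0) → 2 ≤ N₂) :
    2 * (∑ S ∈ N.powerset.filter (fun S => S ≠ ∅ ∧ S ≠ N),
        (1 - ℓ S) * (HY S - HW (N \ S))) + N₂ * (HY ∅ - HW N) ≤ 0 := by
  have hneg : HY ∅ - HW N ≤ 0 := by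
    have := hYW ∅ (Finset.empty_subset N)
    have := hW ∅ (Finset.empty_subset N) N (Finset.Subset.refl N) (Finset.empty_subset N)
    linarith
  have hnegW : HW ∅ - HW N ≤ 0 := by
    have := hW ∅ (Finset.empty_subset N) N (Finset.Subset.refl N) (Finset.empty_subset N)
    linarith
  -- Step 1: `HY ≤ HW` in the doubly-reached part
  have h1 : ∑ S ∈ N.powerset.filter (fun S => S ≠ ∅ ∧ S ≠ N), (1 - ℓ S) * (HY S - HW (N \ S)) ≤
      ∑ S ∈ N.powerset.filter (fun S => S ≠ ∅ ∧ S ≠ N), (1 - ℓ S) * (HW S - HW (N \ S)) := by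
    refine Finset.sum_le_sum (fun S hS => ?_)
    have := hℓ1 S
    have := hYW S (mem_properOf.1 hS).1
    nlinarith
  -- Step 2: antisymmetry turns `(1 − ℓ)` into `−ℓ`
  have h2 : ∑ S ∈ N.powerset.filter (fun S => S ≠ ∅ ∧ S ≠ N), (1 - ℓ S) * (HW S - HW (N \ S)) =
      ∑ S ∈ N.powerset.filter (fun S => S ≠ ∅ ∧ S ≠ N), ℓ S * (HW (N \ S) - HW S) := by
    have hz := sum_properOf_sub_sdiff N HW
    have : ∑ S ∈ N.powerset.filter (fun S => S ≠ ∅ ∧ S ≠ N), (1 - ℓ S) * (HW S - HW (N \ S)) =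
        ∑ S ∈ N.powerset.filter (fun S => S ≠ ∅ ∧ S ≠ N), (HW S - HW (N \ S)) +
          ∑ S ∈ N.powerset.filter (fun S => S ≠ ∅ ∧ S ≠ N), ℓ S * (HW (N \ S) - HW S) := by
      rw [← Finset.sum_add_distrib]
      refine Finset.sum_congr rfl (fun S _ => ?_)
      ring
    rw [this, hz, zero_add]
  by_cases hprop : ∃ S ∈ N.powerset.filter (fun S => S ≠ ∅ ∧ S ≠ N), ℓ S ≠ 0
  · -- some proper subset links: `ℓ N = 1` and `N₂ ≥ 2`
    obtain ⟨S₀, hS₀, hℓS₀⟩ := hprop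
    have hN : N ≠ ∅ := by
      intro h
      have := (mem_properOf.1 hS₀).1
      rw [h, Finset.subset_empty] at this
      exact (mem_properOf.1 hS₀).2.1 this
    have hℓN : ℓ N = 1 := by
      have h01 := hℓ0 S₀
      have h11 := hℓ1 N
      have hmono := hℓ S₀ (mem_properOf.1 hS₀).1 N (Finset.Subset.refl N) (mem_properOf.1 hS₀).1
      omega
    have h2N := hN₂ hℓN ⟨S₀, hS₀, hℓS₀⟩
    -- Step 3: the dirty one-sided part pays two units
    have h3 : N₂ * (HY ∅ - HW N) ≤ 2 * (HW ∅ - HW N) := by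
      have hYW0 := hYW ∅ (Finset.empty_subset N)
      have := mul_le_mul_of_nonpos_right h2N hneg
      linarith
    -- Step 4: Harris on the full powerset
    have hall : ∑ S ∈ N.powerset, ℓ S * (HW (N \ S) - HW S) =
        ∑ S ∈ N.powerset.filter (fun S => S ≠ ∅ ∧ S ≠ N), ℓ S * (HW (N \ S) - HW S) +
          (HW ∅ - HW N) := by
      conv_lhs => rw [powerset_eq_insert_properOf hN]
      rw [Finset.sum_insert (empty_notMem_insert_properOf hN),
        Finset.sum_insert (self_notMem_properOf N), hℓe, hℓN, Finset.sdiff_self,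
        Finset.sdiff_empty]
      ring
    have hH := sum_link_mul_sub_nonpos_powerset N hℓ hW
    rw [hall] at hH
    linarith [h1, h2, h3, hH]
  · -- no proper subset links: the doubly-reached part vanishes after the antisymmetry
    have hall0 : ∀ S ∈ N.powerset.filter (fun S => S ≠ ∅ ∧ S ≠ N), ℓ S = 0 :=
      fun S hS => by_contra (fun h => hprop ⟨S, hS, h⟩)
    have h0 : ∑ S ∈ N.powerset.filter (fun S => S ≠ ∅ ∧ S ≠ N), ℓ S * (HW (N \ S) - HW S) = 0 :=
      Finset.sum_eq_zero (fun S hS => by rw [hall0 S hS, zero_mul])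
    have := mul_nonpos_of_nonneg_of_nonpos hN₂0 hneg
    linarith [h1, h2, h0]

end M9Reduce

end Summit.Ventures.PercRepro2
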